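import Summits.QuantumAdvantage.QuantumAdvantage.Theses.CubicForrelation
import Literature.Computability.QuantumComplexity.ForrelationDerivativeTables

/-!
# Sketch — crux-ideate 3 (round 1) on `SignedExactCubicForrelationNotPrBPP` (stmt-QuantumAdvantage-13932)

First lemmas of the two idea cards (signatures that elaborate; the glue lemmas are PROVED):

* `promiseBPP'_antitone`, `restrictedSignedExact`, `crux_of_restricted` — card
  `keyless-residual-transfer`: hardness of ANY sub-family of the signed exact slice implies the crux
  (PromiseBPP' is antitone in the promise), in particular the family of pairs whose second circuit is
  NOT second-order-flat on a half-dimensional subspace (`¬ HasMMSubspace`, Dillon's criterion for the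
  completed Maiorana–McFarland class): `KeylessResidualHard → crux`.
* `d2`, `d3`, `HasMMSubspace`, `KernelLemma`, `RowDualityLemma` — card `two-sided-closure-dichotomy`:
  the differential-kernel lemma (F1) and the row-duality lemma (F2) behind the two-sided MM peel; both
  are elementary linear algebra over 𝔽₂ (proved on paper in the card / Negative-notes; stated here).
-/

noncomputable section

open Literature.Computability.QuantumComplexity Literature.Computability.Complexity
open Literature.Computability.QuantumComplexity.BuzetChailloux (bxor zeroVec)

namespace Summit.QuantumAdvantage.QuantumAdvantage.Cruxes.SignedExactCubicForrelationNotPrBPP.Ideator3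

/-! ### Card A: sub-promise transfer -/

/-- `PromiseBPP'` is antitone in the promise: shrinking both sides of a promise problem keeps it in
the class (the same `L' ∈ P` and coin polynomial work). [cite: Goldreich2006, §1.1] -/
theorem promiseBPP'_antitone {Q Q' : PromiseProblem} (hy : Q'.yes ≤ Q.yes) (hn : Q'.no ≤ Q.no)
    (h : Q ∈ PromiseBPP') : Q' ∈ PromiseBPP' := by
  obtain ⟨L', hL', p, h1, h2⟩ := h
  exact ⟨L', hL', p, fun x hx => h1 x (hy hx), fun x hx => h2 x (hn hx)⟩

/-- The five defining conditions of the signed exact slice with value `s`. -/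
def IsSignedExact (s : ℝ) (I : KForrelationInstance) : Prop :=
  I.IsOverB2 ∧ I.value = s ∧ I.k = 2 ∧ Even I.n ∧ ∀ i, IsDegLeFun 3 (I.C i).eval

/-- The signed exact slice restricted by an arbitrary side condition `P` on instances. -/
def restrictedSignedExact (P : KForrelationInstance → Prop) : PromiseProblem :=
  ⟨KForrelationInstance.encode '' {I | IsSignedExact 1 I ∧ P I},
   KForrelationInstance.encode '' {I | IsSignedExact (-1) I ∧ P I}⟩

/-- **Card A, first lemma (proved).** Hardness of any restricted family implies the crux. -/
theorem crux_of_restricted (P : KForrelationInstance → Prop)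
    (h : restrictedSignedExact P ∉ PromiseBPP') :
    Theses.CubicForrelation.SignedExactCubicForrelationNotPrBPP := by
  intro hmem
  apply h
  refine promiseBPP'_antitone ?_ ?_ hmem
  · rintro _ ⟨I, ⟨hI, -⟩, rfl⟩
    exact ⟨I, hI, rfl⟩
  · rintro _ ⟨I, ⟨hI, -⟩, rfl⟩
    exact ⟨I, hI, rfl⟩

/-! ### Second and third derivatives, MM subspaces -/

variable {n : ℕ}

/-- Second derivative `D_u D_v b (x)`. -/
def d2 (b : (Fin n → Bool) → Bool) (u v x : Fin n → Bool) : Bool :=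
  (b x ^^ b (bxor x u)) ^^ (b (bxor x v) ^^ b (bxor (bxor x u) v))

/-- Third derivative `D_u D_v D_w b (x)` (constant in `x` when `deg b ≤ 3`: the trilinear form `T_b`). -/
def d3 (b : (Fin n → Bool) → Bool) (u v w x : Fin n → Bool) : Bool :=
  d2 b u v x ^^ d2 b u v (bxor x w)

/-- `U` is an **MM subspace** of `b`: an xor-closed set of size `≥ 2^{n/2}` on whose cosets `b` is
affine (all second derivatives inside `U` vanish).  For a bent `b` the existence of such a `U` of size
exactly `2^{n/2}` is Dillon's criterion for membership in the completed Maiorana–McFarland class.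
[cite: Carlet2020, §6.1 (Dillon's criterion)] -/
def IsMMSubspace (b : (Fin n → Bool) → Bool) (U : Finset (Fin n → Bool)) : Prop :=
  (∀ u ∈ U, ∀ v ∈ U, bxor u v ∈ U) ∧ 2 ^ n ≤ U.card * U.card ∧
    ∀ u ∈ U, ∀ v ∈ U, ∀ x, d2 b u v x = false

/-- `b` has some MM subspace (is 'completed-MM-shaped'). -/
def HasMMSubspace (b : (Fin n → Bool) → Bool) : Prop :=
  ∃ U : Finset (Fin n → Bool), IsMMSubspace b U

/-- **Card B, first lemma (F1, the differential-kernel lemma).** If `deg b ≤ 3` and `U` is an MM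
subspace then for EVERY direction `v` some nonzero `u ∈ U` lies in the kernel of the slice
`M_v = T_b(v,·,·)`, i.e. `T_b(u,v,w) = 0` for all `w`.  (Proof: in adapted coordinates
`T_b((u',0),v,w) = u'·B_π(v'',w'')`, and `w'' ↦ B_π(v'',w'')` has `v''` in its kernel, hence rank
`< dim U`.) -/
def KernelLemma : Prop :=
  ∀ n : ℕ, 2 ≤ n → ∀ b : (Fin n → Bool) → Bool, IsDegLeFun 3 b →
    ∀ U : Finset (Fin n → Bool), IsMMSubspace b U →
      ∀ v : Fin n → Bool, ∃ u ∈ U, u ≠ zeroVec ∧ ∀ w x, d3 b u v w x = false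

/-- **Card B, second lemma (F2, row duality) for an exact cubic pair.** If `Φ(a,b) = ±1`
(both cubic) and `U` is an MM subspace of `b` of size exactly `2^{n/2}`, then for every `u ∈ U`
and every `v`, the functional `w ↦ T_b(u,v,w)` vanishes on `U` — equivalently the rows of `M^b_u` lie
in `U^⊥`, which is an MM subspace of the dual side `a`.  Stated here in the elementary form actually
used by the algorithm (rows of `M^b_u` kill `U`). -/
def RowDualityLemma : Prop :=
  ∀ n : ℕ, ∀ b : (Fin n → Bool) → Bool, IsDegLeFun 3 b →
    ∀ U : Finset (Fin n → Bool), IsMMSubspace b U →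
      ∀ u ∈ U, ∀ v : Fin n → Bool, ∀ w ∈ U, ∀ x, d3 b u v w x = false

/-- The dual side: for an exactly forrelated cubic pair the orthogonal complement of an MM subspace of
`b` (of size exactly `2^{n/2}`) is an MM subspace of `a`. -/
def DualMMSubspace : Prop :=
  ∀ n : ℕ, ∀ a b : (Fin n → Bool) → Bool, IsDegLeFun 3 a → IsDegLeFun 3 b →
    forrelation a b ^ 2 = 1 →
      ∀ U : Finset (Fin n → Bool), IsMMSubspace b U → U.card * U.card = 2 ^ n →
        IsMMSubspace a (Finset.univ.filter fun z => ∀ u ∈ U, (Finset.univ.filter fun i => z i && u i).card % 2 = 0)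

/-! ### Card A's residual hypothesis and its (proved) transfer to the crux -/

/-- The **keyless residual**: the signed exact slice restricted to pairs whose second circuit has NO
MM subspace (exact cubic pairs outside the completed Maiorana–McFarland shape) is not in `prBPP`. -/
def KeylessResidualHard : Prop :=
  restrictedSignedExact (fun I => ∀ h : I.k = 2, ¬ HasMMSubspace (I.C (Fin.cast h.symm 1)).eval)
    ∉ PromiseBPP'

/-- **Transfer (proved):** the keyless residual implies the crux. -/
theorem crux_of_keylessResidual (h : KeylessResidualHard) :
    Theses.CubicForrelation.SignedExactCubicForrelationNotPrBPP :=
  crux_of_restricted _ h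

/-- Card B's residual hypothesis: hardness on MM-shaped pairs whose template lies in the
closure-degenerate class `R` (left abstract here as a predicate on instances; the card defines it via
the bilinear closure operators of `(B_π, B_{π⁻¹})`).  Its transfer to the crux is the same glue. -/
theorem crux_of_family (R : KForrelationInstance → Prop)
    (h : restrictedSignedExact R ∉ PromiseBPP') :
    Theses.CubicForrelation.SignedExactCubicForrelationNotPrBPP :=
  crux_of_restricted R h


/-! ### Card C: collapsing the pair — the (anti-)self-dual sub-slice -/

/-- Side condition "the two circuits compute the SAME function" (`a = b`): on the signed exact slice these
are exactly the instances `(b, b)` with `b` cubic bent and SELF-DUAL (`Φ(b,b) = 1`, yes) or ANTI-SELF-DUAL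
(`Φ(b,b) = -1`, no) — the Rayleigh-quotient sign problem for cubic bent functions. -/
def SameFunction (I : KForrelationInstance) : Prop :=
  ∀ h : I.k = 2, (I.C (Fin.cast h.symm 0)).eval = (I.C (Fin.cast h.symm 1)).eval

/-- **Card C's hypothesis**: the self-dual / anti-self-dual sub-slice is not in `prBPP`. -/
def SelfDualSliceHard : Prop :=
  restrictedSignedExact SameFunction ∉ PromiseBPP'

/-- **Transfer (proved):** hardness of the (anti-)self-dual sub-slice implies the crux. -/
theorem crux_of_selfDualSlice (h : SelfDualSliceHard) :
    Theses.CubicForrelation.SignedExactCubicForrelationNotPrBPP :=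
  crux_of_restricted _ h

/-- `b` is a cubic (anti-)self-dual bent function: `Φ(b,b) = ±1`, i.e. `b̃ = b` or `b̃ = b ⊕ 1`. -/
def IsCubicSelfDualType (b : (Fin n → Bool) → Bool) : Prop :=
  IsDegLeFun 3 b ∧ forrelation b b ^ 2 = 1

/-- **Card C's load-bearing existence stub** (open; first open case `n = 10`): for infinitely many even `n`
there is a cubic (anti-)self-dual bent function with NO MM subspace (outside the completed
Maiorana–McFarland shape).  Without it `SelfDualSliceHard` restricted to keyless instances is vacuous. -/
def SelfDualKeylessNonempty : Prop :=
  ∀ N : ℕ, ∃ n, N ≤ n ∧ Even n ∧ ∃ b : (Fin n → Bool) → Bool, IsCubicSelfDualType b ∧ ¬ HasMMSubspace b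

end Summit.QuantumAdvantage.QuantumAdvantage.Cruxes.SignedExactCubicForrelationNotPrBPP.Ideator3

end
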